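import Literature.Analysis.Fourier.PorousFractalUncertainty
import Literature.Analysis.Fourier.FractalUncertaintyPrinciple
import Literature.Analysis.Fourier.PorousSetsRegularCover
import Literature.Analysis.Fourier.RegularSets
import Mathlib.MeasureTheory.Measure.Haar.NormedSpace
import Mathlib.MeasureTheory.Function.L2Space
import HarnessLib

/-!
# Towards Dyatlov–Jin–Nonnenmacher 2021, Proposition 2.9 (FUP for `ν`-porous sets): proved steps

Topic `Literature/Analysis/Fourier`. Companion ("Proofs" file) of `PorousFractalUncertainty.lean`,
which states the named fact `dyatlovJinNonnenmacher2021_prop_2_9` (D-0014), and of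
`FractalUncertaintyPrinciple.lean` (`IsRegularSet`, named fact `bourgainDyatlov2018_thm4`).

The printed proof of DJN Proposition 2.9 [DyatlovJinNonnenmacher2021, §2.4, proof of Prop. 2.9,
Steps 1–5] reduces the estimate `‖𝟙_{Ω₋} 𝓕_h 𝟙_{Ω₊}‖ ≤ C h^β` for unbounded `ν`-porous sets to the
fractal uncertainty principle of Bourgain–Dyatlov [BourgainDyatlov2018, Theorem 4] (Step 4, via
[BourgainDyatlov2018, Prop. 4.2 (4.3)] and the porous-to-regular cover of Dyatlov–Jin), using smooth
`h`-cutoffs, a partition of unity, the Cotlar–Stein lemma and non-stationary phase (Steps 1–3, 5).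
`bourgainDyatlov2018_thm4` is itself an (unproved) named fact of the tree, so the discharge
`dyatlovJinNonnenmacher2021_prop_2_9_holds` is blocked on it. This file proves, sorry-free, the
self-contained steps of that reduction which do not need new facts:

* `IsPorousOnScales.eq_empty_of_half_le` — for `ν ≥ 1/2` only `∅` is `ν`-porous on a range of scales
  containing a positive length (a pore of relative length `≥ 1/2` inside an interval centred at a
  point of the set must contain the centre); hence
  `dyatlovJinNonnenmacher2021_prop_2_9_of_half_le` — **the fact in the range `1/2 ≤ ν`** (vacuous
  range; the content of Prop. 2.9 is `0 < ν < 1/2`).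
* porosity under affine maps (`IsPorousOnScales.image_add_const`, `.image_mul_left`, `.image_neg`) —
  the rescalings `Ω̂± = h^{-γ} Ω±` of [DyatlovJinNonnenmacher2021, proof of Prop. 2.10] and the shifts
  `Ω±^j = Ω̃± - j` of Step 4.
* regularity under dilations and reflection (`IsRegularSet.image_mul_left`, `.image_neg`) —
  [BourgainDyatlov2018, Lemma 2.1 (affine transformations)], with the printed measure
  `μ_{X̃}(A) = λ^δ μ_X(λ⁻¹ A)`; shrinking of scales is `IsRegularSet.mono_scales`
  (`RegularSets.lean`).
* `fourierSemiclassical_eq_fourierInv` — the semiclassical Fourier transform (DJN (2.32)) is a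
  rescaled Fourier integral in Mathlib's / BD18's convention:
  `𝓕_h u = 𝓕⁻ g`, `g(y) = (2πh)^{1/2} u(-2πh y)`, `‖g‖₂ = ‖u‖₂` (`integral_norm_sq_rescale`).
* `fup_regular_semiclassical_of_bd18` — **Step 4's engine, from the BD18 fact**: the semiclassical
  FUP for `δ`-regular sets, i.e. [Dyatlov2019, §2.3 Theorem 1] = [BourgainDyatlov2018, (4.3) in the
  proof of Prop. 4.2] ("take `g ∈ L²`, `f := 𝓕_h^* 𝟙_Y g`, `N := h⁻¹`; then `supp f̂ ⊂ N·Y` is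
  `δ`-regular on scales `1` to `N` by Lemma 2.1; apply Theorem 4"): for `0 ≤ δ < 1`, `C_R ≥ 1` there
  are `β, C > 0` (depending only on `δ, C_R`) with
  `∫_X |𝓕_h u|² ≤ (C h^β)² ‖u‖₂²` for all `0 < h ≤ 1`, all `X, Y ⊆ [-1,1]` `δ`-regular with constant
  `C_R` on scales `h` to `1`, and all `u ∈ L²` vanishing off `Y`. In DJN's normalisation of `𝓕_h`
  the rescaling is `N = (2πh)⁻¹` ("[BD18] used a slightly different normalization of `𝓕_h`, rescaled
  by a factor of `2π`, which however makes no difference", DJN Step 4); for `2πh > 1` (where `N < 1`)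
  the bound is the trivial one from `‖𝓕_h‖_{L¹→L^∞} ≤ (2πh)^{-1/2}` and `‖u‖₁ ≤ (3/2)‖u‖₂` on
  `[-1,1]`.

* `dyatlov2019_thm3_of_bd18` — **the FUP for POROUS sets in `[-1,1]` from the BD18 fact**
  ([Dyatlov2019, §2.3 Theorem 3]; the bounded case of DJN Prop. 2.9, i.e. Step 4 for one pair of
  windows): combine `fup_regular_semiclassical_of_bd18` with the porous → regular cover
  `exists_regular_superset_of_porous` (`PorousSetsRegularCover.lean`: [DyatlovJin2018Acta,
  Lemma 5.4] = [Dyatlov2019, Prop. 1(2)], proved) and monotonicity of `∫_X |𝓕_h u|²` in `X`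
  (`continuous_fourierSemiclassical` supplies integrability); and its translate
  `porousFUP_window_of_bd18` to an arbitrary pair of windows `X ⊆ [j-1, j+1]`, `Y ⊆ [k-1, k+1]`
  ("the norm `‖𝟙_X 𝓕_h^* 𝟙_Y‖` does not change when shifting `X` and/or `Y`", DJN Step 4, first
  inequality of (2.41)), via `fourierSemiclassical_comp_add_right` (translation ↦ phase) and
  `fourierSemiclassical_modulate` (modulation ↦ frequency shift) — this is the bound (2.38)
  `‖A_{jk}‖ ≤ C h^{β}` for the sharp-cutoff pieces `𝟙_{X∩[j-1,j+1]} 𝓕_h 𝟙_{Y∩[k-1,k+1]}`.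

What is still missing for `dyatlovJinNonnenmacher2021_prop_2_9_holds` (recorded, not vendored):
`bourgainDyatlov2018_thm4_holds` (BD18 §§2–4), and DJN Steps 1–3, 5 (smooth cutoffs, partition of
unity, Cotlar–Stein, non-stationary phase) passing from windows `[-1,1]` to unbounded sets.

## References

* [DyatlovJinNonnenmacher2021] S. Dyatlov, L. Jin, S. Nonnenmacher, *Control of eigenfunctions on
  surfaces of variable curvature*, J. Amer. Math. Soc. 35 (2022), 361–465 = arXiv:1906.08923, §2.4:
  Def. 2.8, (2.32), Prop. 2.9 and its proof (Steps 1–5), Prop. 2.10, Lemma 2.11.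
* [BourgainDyatlov2018] J. Bourgain, S. Dyatlov, *Spectral gaps without the pressure condition*,
  Ann. of Math. 187 (2018), 825–867 = arXiv:1612.09040: Def. 1.1, Thm. 4, Lemma 2.1, Prop. 4.2.
* [Dyatlov2019] S. Dyatlov, *An introduction to fractal uncertainty principle*, J. Math. Phys. 60
  (2019), 081505 = arXiv:1903.02599: §2.2 Def. 2, Def. 3, Prop. 1; §2.3 Thm. 1, Thm. 3.
* [DyatlovJin2018Acta] S. Dyatlov, L. Jin, *Semiclassical measures on hyperbolic surfaces have full
  support*, Acta Math. 220 (2018), 297–339 = arXiv:1705.05019, §5.1 Lemma 5.4, Prop. 5.5.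
-/

noncomputable section

open _root_.MeasureTheory Set Real
open scoped FourierTransform

namespace Literature.Analysis.Fourier

/-! ## Porosity: the vacuous range `ν ≥ 1/2` and affine invariance -/

namespace IsPorousOnScales

variable {X : Set ℝ} {ν α₀ α₁ : ℝ}

/-- For `ν ≥ 1/2` a **nonempty** set is never `ν`-porous on a range of scales `[α₀, α₁]` containing
a positive length `ℓ`: the interval of length `ℓ` centred at a point `x ∈ X` would contain a pore
`[c, d]` of length `ν ℓ ≥ ℓ/2`, and such a pore contains the centre `x`. So only `∅` is porous
there. (This is why the content of the porous FUP lies in `ν < 1/2`; cf. `singleton`.) [folklore] -/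
theorem eq_empty_of_half_le (h : IsPorousOnScales X ν α₀ α₁) (hν : 1 / 2 ≤ ν) {ℓ : ℝ}
    (hℓ : 0 < ℓ) (h0 : α₀ ≤ ℓ) (h1 : ℓ ≤ α₁) : X = ∅ := by
  rw [Set.eq_empty_iff_forall_notMem]
  intro x hx
  obtain ⟨c, d, hac, hdb, hdc, hdisj⟩ :=
    h (x - ℓ / 2) (x + ℓ / 2) (by linarith) (by linarith) (by linarith)
  have hνℓ : 1 / 2 * ℓ ≤ ν * ℓ := mul_le_mul_of_nonneg_right hν hℓ.le
  refine Set.disjoint_left.1 hdisj ⟨?_, ?_⟩ hx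
  · linarith
  · linarith

/-- Porosity is invariant under translations `x ↦ x + c₀`. [cite: DyatlovJinNonnenmacher2021, §2.4, proof of Prop. 2.9, Step 4 ("these sets are still … regular" after shifting)] [folklore] -/
theorem image_add_const (h : IsPorousOnScales X ν α₀ α₁) (c₀ : ℝ) :
    IsPorousOnScales ((fun x => x + c₀) '' X) ν α₀ α₁ := by
  intro a b hab h0 h1
  obtain ⟨c, d, hac, hdb, hdc, hdisj⟩ :=
    h (a - c₀) (b - c₀) (by linarith) (by linarith) (by linarith)
  refine ⟨c + c₀, d + c₀, by linarith, by linarith, by linarith, ?_⟩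
  rw [Set.disjoint_left]
  rintro _ ⟨hx1, hx2⟩ ⟨y, hy, rfl⟩
  exact Set.disjoint_left.1 hdisj ⟨by linarith, by linarith⟩ hy

/-- Porosity under dilations `x ↦ t x`, `t > 0`: the scales are multiplied by `t`
(`Ω̂ = h^{-γ} Ω` is `ν`-porous on scales `h^{-γ} α₀` to `h^{-γ} α₁`). [cite: DyatlovJinNonnenmacher2021, §2.4, proof of Prop. 2.10] -/
theorem image_mul_left (h : IsPorousOnScales X ν α₀ α₁) {t : ℝ} (ht : 0 < t) :
    IsPorousOnScales ((fun x => t * x) '' X) ν (t * α₀) (t * α₁) := by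
  intro a b hab h0 h1
  obtain ⟨c, d, hac, hdb, hdc, hdisj⟩ := h (a / t) (b / t) (div_lt_div_of_pos_right hab ht)
    (by rw [← sub_div, le_div_iff₀ ht]; linarith) (by rw [← sub_div, div_le_iff₀ ht]; linarith)
  rw [div_le_iff₀ ht] at hac
  rw [le_div_iff₀ ht] at hdb
  refine ⟨t * c, t * d, by linarith, by linarith, ?_, ?_⟩
  · have : t * (b / t - a / t) = b - a := by field_simp
    calc t * d - t * c = t * (d - c) := by ring
      _ = ν * (t * (b / t - a / t)) := by rw [hdc]; ring
      _ = ν * (b - a) := by rw [this]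
  · rw [Set.disjoint_left]
    rintro _ ⟨hx1, hx2⟩ ⟨y, hy, rfl⟩
    exact Set.disjoint_left.1 hdisj
      ⟨le_of_mul_le_mul_left hx1 ht, le_of_mul_le_mul_left hx2 ht⟩ hy

/-- Porosity is invariant under the reflection `x ↦ -x`. [folklore] -/
theorem image_neg (h : IsPorousOnScales X ν α₀ α₁) :
    IsPorousOnScales ((fun x => -x) '' X) ν α₀ α₁ := by
  intro a b hab h0 h1
  obtain ⟨c, d, hac, hdb, hdc, hdisj⟩ := h (-b) (-a) (by linarith) (by linarith) (by linarith)
  refine ⟨-d, -c, by linarith, by linarith, by linarith, ?_⟩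
  rw [Set.disjoint_left]
  rintro _ ⟨hx1, hx2⟩ ⟨y, hy, rfl⟩
  exact Set.disjoint_left.1 hdisj ⟨by linarith, by linarith⟩ hy

end IsPorousOnScales

/-- **DJN Proposition 2.9 in the range `1/2 ≤ ν` (vacuous range).** For `1/2 ≤ ν` and `0 < h ≤ 1`
the only set which is `ν`-porous on scales `h` to `1` is `∅` (`IsPorousOnScales.eq_empty_of_half_le`
with `ℓ = 1`), so the estimate of `dyatlovJinNonnenmacher2021_prop_2_9` holds trivially there (any
`β, C > 0`; here `β = C = 1`): `∫_∅ |𝓕_h u|² = 0`. The genuine content of the fact is the range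
`0 < ν < 1/2`, which needs `bourgainDyatlov2018_thm4`. [cite: DyatlovJinNonnenmacher2021, Proposition 2.9] -/
theorem dyatlovJinNonnenmacher2021_prop_2_9_of_half_le (ν : ℝ) (hν : 1 / 2 ≤ ν) :
    ∃ β : ℝ, 0 < β ∧ ∃ C : ℝ, 0 < C ∧
    ∀ h : ℝ, 0 < h → h ≤ 1 → ∀ X Y : Set ℝ, MeasurableSet X → MeasurableSet Y →
      IsPorousOnScales X ν h 1 → IsPorousOnScales Y ν h 1 →
        ∀ u : ℝ → ℂ, Integrable u → MemLp u 2 volume → (∀ x, x ∉ Y → u x = 0) →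
          ∫ ξ in X, ‖fourierSemiclassical h u ξ‖ ^ 2 ≤ (C * h ^ β) ^ 2 * ∫ x, ‖u x‖ ^ 2 := by
  refine ⟨1, one_pos, 1, one_pos, ?_⟩
  intro h _ hh1 X _ _ _ hX _ _ _ _ _
  have hXe : X = ∅ := hX.eq_empty_of_half_le hν one_pos hh1 le_rfl
  subst hXe
  rw [Measure.restrict_empty, integral_zero_measure]
  exact mul_nonneg (sq_nonneg _) (integral_nonneg fun _ => by positivity)

/-! ## Regular sets: dilations and reflection (BD18 Lemma 2.1) -/

namespace IsRegularSet

variable {X : Set ℝ} {δ C_R α₀ α₁ : ℝ}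

/-- **BD18 Lemma 2.1 (affine transformations), dilation part:** if `X` is `δ`-regular with constant
`C_R` on scales `α₀` to `α₁` and `t > 0` then `t X` is `δ`-regular with the same constant on scales
`t α₀` to `t α₁`, with the measure `μ_{tX}(A) = t^δ μ_X(t⁻¹ A)`. [cite: BourgainDyatlov2018, Lemma 2.1] -/
theorem image_mul_left (h : IsRegularSet X δ C_R α₀ α₁) {t : ℝ} (ht : 0 < t) :
    IsRegularSet ((fun x => t * x) '' X) δ C_R (t * α₀) (t * α₁) := by
  obtain ⟨hne, hcl, μ, hμ, H⟩ := h
  have hclt : IsClosed ((fun x => t * x) '' X) :=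
    (Homeomorph.mulLeft₀ t ht.ne').isClosed_image.2 hcl
  refine ⟨hne.image _, hclt, ENNReal.ofReal (t ^ δ) • Measure.map (fun x => t * x) μ, ?_, ?_⟩
  · rw [Measure.smul_apply, Measure.map_apply (measurable_const_mul t) hclt.measurableSet.compl]
    have hsub : (fun x => t * x) ⁻¹' ((fun x => t * x) '' X)ᶜ ⊆ Xᶜ := by
      rw [Set.preimage_compl, Set.compl_subset_compl]
      exact Set.subset_preimage_image _ _
    rw [measure_mono_null hsub hμ, smul_zero]
  · intro a b hab ha hb
    have hpre : (fun x => t * x) ⁻¹' Icc a b = Icc (a / t) (b / t) := by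
      ext x
      simp only [Set.mem_preimage, Set.mem_Icc, div_le_iff₀ ht, le_div_iff₀ ht]
      constructor <;> rintro ⟨h1, h2⟩ <;> constructor <;> linarith
    have hlen : b / t - a / t = (b - a) / t := by ring
    obtain ⟨H1, H2⟩ := H (a / t) (b / t) (div_lt_div_of_pos_right hab ht)
      (by rw [hlen, le_div_iff₀ ht]; linarith) (by rw [hlen, div_le_iff₀ ht]; linarith)
    have hpow : t ^ δ * ((b - a) / t) ^ δ = (b - a) ^ δ := by
      rw [Real.div_rpow (sub_pos.2 hab).le ht.le, mul_div_cancel₀ _ (Real.rpow_pos_of_pos ht δ).ne']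
    rw [Measure.smul_apply, Measure.map_apply (measurable_const_mul t) measurableSet_Icc, hpre,
      smul_eq_mul]
    have e1 : t ^ δ * (C_R * ((b - a) / t) ^ δ) = C_R * (b - a) ^ δ := by rw [← hpow]; ring
    have e2 : t ^ δ * (C_R⁻¹ * ((b - a) / t) ^ δ) = C_R⁻¹ * (b - a) ^ δ := by rw [← hpow]; ring
    rw [hlen] at H1 H2
    constructor
    · calc ENNReal.ofReal (t ^ δ) * μ (Icc (a / t) (b / t))
          ≤ ENNReal.ofReal (t ^ δ) * ENNReal.ofReal (C_R * ((b - a) / t) ^ δ) := by gcongr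
        _ = ENNReal.ofReal (C_R * (b - a) ^ δ) := by
            rw [← ENNReal.ofReal_mul (Real.rpow_nonneg ht.le _), e1]
    · intro hmid
      have hmid' : (a / t + b / t) / 2 ∈ X := by
        obtain ⟨x, hx, hxe⟩ := hmid
        have htx : t * x = (a + b) / 2 := hxe
        have : x = (a / t + b / t) / 2 := by
          field_simp
          linarith
        exact this ▸ hx
      calc ENNReal.ofReal (C_R⁻¹ * (b - a) ^ δ)
          = ENNReal.ofReal (t ^ δ) * ENNReal.ofReal (C_R⁻¹ * ((b - a) / t) ^ δ) := by
            rw [← ENNReal.ofReal_mul (Real.rpow_nonneg ht.le _), e2]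
        _ ≤ ENNReal.ofReal (t ^ δ) * μ (Icc (a / t) (b / t)) := by gcongr; exact H2 hmid'

/-- **BD18 Lemma 2.1, reflection:** `-X` is `δ`-regular with the same constant on the same scales
(measure `μ_{-X}(A) = μ_X(-A)`; the midpoint of `[a, b]` lies in `-X` iff the midpoint of `[-b, -a]`
lies in `X`). [cite: BourgainDyatlov2018, Lemma 2.1] [folklore] -/
theorem image_neg (h : IsRegularSet X δ C_R α₀ α₁) :
    IsRegularSet ((fun x => -x) '' X) δ C_R α₀ α₁ := by
  obtain ⟨hne, hcl, μ, hμ, H⟩ := h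
  have hcln : IsClosed ((fun x : ℝ => -x) '' X) := (Homeomorph.neg ℝ).isClosed_image.2 hcl
  refine ⟨hne.image _, hcln, Measure.map (fun x => -x) μ, ?_, ?_⟩
  · rw [Measure.map_apply measurable_neg hcln.measurableSet.compl]
    have hsub : (fun x : ℝ => -x) ⁻¹' ((fun x : ℝ => -x) '' X)ᶜ ⊆ Xᶜ := by
      rw [Set.preimage_compl, Set.compl_subset_compl]
      exact Set.subset_preimage_image _ _
    exact measure_mono_null hsub hμ
  · intro a b hab ha hb
    have hpre : (fun x : ℝ => -x) ⁻¹' Icc a b = Icc (-b) (-a) := by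
      ext x
      simp only [Set.mem_preimage, Set.mem_Icc]
      constructor <;> rintro ⟨h1, h2⟩ <;> constructor <;> linarith
    obtain ⟨H1, H2⟩ := H (-b) (-a) (by linarith) (by linarith) (by linarith)
    rw [Measure.map_apply measurable_neg measurableSet_Icc, hpre]
    rw [show -a - -b = b - a by ring] at H1 H2
    refine ⟨H1, fun hmid => H2 ?_⟩
    obtain ⟨x, hx, hxe⟩ := hmid
    have : x = (-b + -a) / 2 := by simp only at hxe; linarith
    exact this ▸ hx

end IsRegularSet

/-! ## The semiclassical Fourier transform as a rescaled Fourier integral -/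

/-- **`𝓕_h` in Mathlib's convention.** For `h > 0`, `u : ℝ → ℂ` and every `ξ`,
`𝓕_h u(ξ) = (2πh)^{-1/2} ∫ e^{-ixξ/h} u(x) dx = ∫ e^{2πiyξ} g(y) dy = 𝓕⁻ g(ξ)` with
`g(y) := (2πh)^{1/2} u(-2πh y)` (substitute `x = -2πh y`; no integrability needed, both sides being
the same possibly divergent integral). This is the "rescaling by a factor of `2π`" between DJN's
`𝓕_h` and BD18's Fourier transform. [cite: DyatlovJinNonnenmacher2021, §2.4 (2.32) and proof of Prop. 2.9, Step 4] [cite: BourgainDyatlov2018, §2.1] -/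
theorem fourierSemiclassical_eq_fourierInv {h : ℝ} (hh : 0 < h) (u : ℝ → ℂ) (ξ : ℝ) :
    fourierSemiclassical h u ξ =
      (𝓕⁻ (fun y : ℝ => (((2 * π * h) ^ (1 / 2 : ℝ) : ℝ) : ℂ) * u (-(2 * π * h) * y)) : ℝ → ℂ) ξ := by
  have h2 : 0 < 2 * π * h := by positivity
  have hh0 : (h : ℂ) ≠ 0 := Complex.ofReal_ne_zero.2 hh.ne'
  rw [Real.fourierInv_eq_fourier_neg, Real.fourier_real_eq_integral_exp_smul, fourierSemiclassical]
  set a : ℝ := -(2 * π * h) with ha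
  set G : ℝ → ℂ := fun x => Complex.exp (-(Complex.I * (x : ℂ) * (ξ : ℂ) / (h : ℂ))) * u x with hG
  have key : ∀ v : ℝ, Complex.exp (↑(-2 * π * v * -ξ) * Complex.I) •
      ((((2 * π * h) ^ (1 / 2 : ℝ) : ℝ) : ℂ) * u (a * v)) =
        (((2 * π * h) ^ (1 / 2 : ℝ) : ℝ) : ℂ) * G (a * v) := by
    intro v
    rw [hG, smul_eq_mul]
    simp only
    have hexp : (↑(-2 * π * v * -ξ) * Complex.I : ℂ) =
        -(Complex.I * ((a * v : ℝ) : ℂ) * (ξ : ℂ) / (h : ℂ)) := by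
      rw [ha]
      push_cast
      field_simp
    rw [hexp]
    ring
  simp_rw [key]
  rw [integral_const_mul, Measure.integral_comp_mul_left G a, Complex.real_smul, ← mul_assoc,
    ← Complex.ofReal_mul]
  congr 2
  rw [ha, inv_neg, abs_neg, abs_of_pos (inv_pos.2 h2), ← Real.rpow_neg_one,
    ← Real.rpow_add h2]
  norm_num

/-- The rescaling `g(y) = (2πh)^{1/2} u(-2πh y)` is unitary on `L²`: `∫ |g|² = ∫ |u|²`. [folklore] -/
theorem integral_norm_sq_rescale {h : ℝ} (hh : 0 < h) (u : ℝ → ℂ) :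
    ∫ y : ℝ, ‖(((2 * π * h) ^ (1 / 2 : ℝ) : ℝ) : ℂ) * u (-(2 * π * h) * y)‖ ^ 2 =
      ∫ x : ℝ, ‖u x‖ ^ 2 := by
  have h2 : 0 < 2 * π * h := by positivity
  have hsq : ((2 * π * h) ^ (1 / 2 : ℝ)) ^ 2 = 2 * π * h := by
    rw [← Real.rpow_natCast, ← Real.rpow_mul h2.le]; norm_num
  have : ∀ y : ℝ, ‖(((2 * π * h) ^ (1 / 2 : ℝ) : ℝ) : ℂ) * u (-(2 * π * h) * y)‖ ^ 2 =
      (2 * π * h) * (fun x => ‖u x‖ ^ 2) (-(2 * π * h) * y) := by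
    intro y
    rw [norm_mul, Complex.norm_real, Real.norm_of_nonneg (Real.rpow_nonneg h2.le _), mul_pow, hsq]
  simp_rw [this]
  rw [integral_const_mul, Measure.integral_comp_mul_left (fun x => ‖u x‖ ^ 2), inv_neg, abs_neg,
    abs_of_pos (inv_pos.2 h2), smul_eq_mul, ← mul_assoc, mul_inv_cancel₀ h2.ne', one_mul]

/-- The rescaling `g(y) = (2πh)^{1/2} u(-2πh y)` of an `L²` function is `L²`. [folklore] -/
theorem memLp_rescale {h : ℝ} (hh : 0 < h) {u : ℝ → ℂ} (hu : MemLp u 2 volume) :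
    MemLp (fun y : ℝ => (((2 * π * h) ^ (1 / 2 : ℝ) : ℝ) : ℂ) * u (-(2 * π * h) * y)) 2 volume := by
  have h2 : 0 < 2 * π * h := by positivity
  have ha0 : -(2 * π * h) ≠ 0 := neg_ne_zero.2 h2.ne'
  have hmap : MemLp u 2 (Measure.map (fun y : ℝ => -(2 * π * h) * y) volume) := by
    rw [Real.map_volume_mul_left ha0]
    exact hu.smul_measure ENNReal.ofReal_ne_top
  exact (hmap.comp_of_map (measurable_const_mul _).aemeasurable).const_mul _

/-! ## Step 4's engine: the semiclassical FUP for regular sets from BD18 Theorem 4 -/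

/-- `‖u‖_{L¹} ≤ (3/2) ‖u‖_{L²}` for `u ∈ L²(ℝ)` vanishing off `[-1, 1]`, in the squared form
`(∫ ‖u‖)² ≤ (9/4) ∫ ‖u‖²` (from the pointwise `2 s |u| ≤ s² + |u|²` with `s = ‖u‖₂`; the sharp
Cauchy–Schwarz constant `2` is not needed). [folklore] -/
theorem sq_integral_norm_le_of_support {u : ℝ → ℂ} (hu : MemLp u 2 volume)
    (hu0 : ∀ x, x ∉ Icc (-1 : ℝ) 1 → u x = 0) :
    (∫ x, ‖u x‖) ^ 2 ≤ 9 / 4 * ∫ x, ‖u x‖ ^ 2 := by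
  have hint2 : Integrable (fun x => ‖u x‖ ^ 2) volume :=
    (memLp_two_iff_integrable_sq_norm hu.aestronglyMeasurable).1 hu
  set S : ℝ := ∫ x, ‖u x‖ ^ 2 with hS
  have hS0 : 0 ≤ S := integral_nonneg fun _ => by positivity
  have hsupp : ∫ x, ‖u x‖ = ∫ x in Icc (-1 : ℝ) 1, ‖u x‖ :=
    (setIntegral_eq_integral_of_forall_compl_eq_zero (fun x hx => by rw [hu0 x hx, norm_zero])).symm
  rcases hS0.eq_or_lt with hS00 | hSpos
  · -- `‖u‖₂ = 0`: then `u = 0` a.e. and both sides vanish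
    have hae : (fun x => ‖u x‖ ^ 2) =ᵐ[volume] 0 :=
      (integral_eq_zero_iff_of_nonneg (fun _ => by positivity) hint2).1 hS00.symm
    have hae' : (fun x => ‖u x‖) =ᵐ[volume] (fun _ => (0 : ℝ)) := by
      filter_upwards [hae] with x hx
      simpa using hx
    rw [integral_congr_ae hae', integral_zero, ← hS00]
    norm_num
  · set s : ℝ := Real.sqrt S with hs
    have hspos : 0 < s := Real.sqrt_pos.2 hSpos
    have hs2 : s ^ 2 = S := Real.sq_sqrt hS0
    -- pointwise AM–GM on `[-1, 1]`
    have hpt : ∀ x, ‖u x‖ ≤ (s ^ 2 + ‖u x‖ ^ 2) / (2 * s) := by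
      intro x
      rw [le_div_iff₀ (by positivity)]
      nlinarith [sq_nonneg (s - ‖u x‖)]
    have hI : ∫ x in Icc (-1 : ℝ) 1, ‖u x‖ ≤ ∫ x in Icc (-1 : ℝ) 1, (s ^ 2 + ‖u x‖ ^ 2) / (2 * s) := by
      refine integral_mono_of_nonneg (Filter.Eventually.of_forall fun x => norm_nonneg _) ?_
        (Filter.Eventually.of_forall hpt)
      exact ((integrable_const _).add hint2.integrableOn).div_const _
    have hI2 : ∫ x in Icc (-1 : ℝ) 1, (s ^ 2 + ‖u x‖ ^ 2) / (2 * s) =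
        (2 * s ^ 2 + ∫ x in Icc (-1 : ℝ) 1, ‖u x‖ ^ 2) / (2 * s) := by
      rw [integral_div, integral_add (integrable_const _) hint2.integrableOn, setIntegral_const,
        Real.volume_real_Icc_of_le (by norm_num), smul_eq_mul]
      norm_num
    have hI3 : ∫ x in Icc (-1 : ℝ) 1, ‖u x‖ ^ 2 ≤ S :=
      setIntegral_le_integral hint2 (Filter.Eventually.of_forall fun _ => by positivity)
    have hle : ∫ x, ‖u x‖ ≤ 3 / 2 * s := by
      rw [hsupp]
      refine hI.trans ?_
      rw [hI2, div_le_iff₀ (by positivity)]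
      nlinarith
    have hnn : 0 ≤ ∫ x, ‖u x‖ := integral_nonneg fun _ => norm_nonneg _
    nlinarith

/-- **The semiclassical fractal uncertainty principle for `δ`-regular sets, from BD18 Theorem 4**
(Dyatlov 2019, Theorem 1; Bourgain–Dyatlov 2018, estimate (4.3) in the proof of Proposition 4.2 —
the input of DJN's proof of Prop. 2.9, Step 4). Let `0 ≤ δ < 1` and `C_R ≥ 1`. Then there exist
`β = β(δ, C_R) > 0` and `C = C(δ, C_R) > 0` such that for all `0 < h ≤ 1`, all `X, Y ⊆ [-1, 1]`
which are `δ`-regular with constant `C_R` on scales `h` to `1`, and all `u ∈ L²(ℝ)` vanishing off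
`Y`: `∫_X |𝓕_h u(ξ)|² dξ ≤ (C h^β)² ∫ |u|²`, i.e. `‖𝟙_X 𝓕_h 𝟙_Y‖_{L² → L²} ≤ C h^β`.
Proof as printed in BD18: with `N := (2πh)⁻¹ ≥ 1` and `g(y) := (2πh)^{1/2} u(-2πh y)` one has
`𝓕_h u = 𝓕⁻ g` (`fourierSemiclassical_eq_fourierInv`), `‖g‖₂ = ‖u‖₂`, `supp g ⊆ -N·Y ⊆ [-N, N]`
is `δ`-regular with constant `C_R` on scales `(2π)⁻¹` to `N`, in particular on scales `1` to `N`
(BD18 Lemma 2.1), and `X` is regular on scales `N⁻¹ = 2πh ≥ h` to `1`; BD18 Theorem 4 gives the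
bound `C N^{-β} = C (2π)^β h^β`. For `2πh > 1` the trivial bound `‖𝓕_h‖_{L¹ → L^∞} ≤ (2πh)^{-1/2}`,
`vol ≤ 2`, `‖u‖₁ ≤ (3/2)‖u‖₂` is used instead. Constant: `C' = (|C| + 3)(2π)^β`. [cite: Dyatlov2019, §2.3 Theorem 1] [cite: BourgainDyatlov2018, Proposition 4.2, (4.3)] [cite: DyatlovJinNonnenmacher2021, §2.4, proof of Prop. 2.9, Step 4] -/
theorem fup_regular_semiclassical_of_bd18 (hbd : bourgainDyatlov2018_thm4) :
    ∀ δ C_R : ℝ, 0 ≤ δ → δ < 1 → 1 ≤ C_R → ∃ β : ℝ, 0 < β ∧ ∃ C : ℝ, 0 < C ∧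
      ∀ h : ℝ, 0 < h → h ≤ 1 → ∀ X Y : Set ℝ, X ⊆ Icc (-1) 1 → Y ⊆ Icc (-1) 1 →
        IsRegularSet X δ C_R h 1 → IsRegularSet Y δ C_R h 1 →
          ∀ u : ℝ → ℂ, MemLp u 2 volume → (∀ x, x ∉ Y → u x = 0) →
            ∫ ξ in X, ‖fourierSemiclassical h u ξ‖ ^ 2 ≤ (C * h ^ β) ^ 2 * ∫ x, ‖u x‖ ^ 2 := by
  intro δ C_R hδ0 hδ1 hCR
  obtain ⟨β, hβ, C, H⟩ := hbd δ C_R hδ0 hδ1 hCR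
  have h2π : (1 : ℝ) ≤ 2 * π := by linarith [Real.two_le_pi]
  have h2πpos : (0 : ℝ) < 2 * π := by positivity
  refine ⟨β, hβ, (|C| + 3) * (2 * π) ^ β, by positivity, ?_⟩
  intro h hh hh1 X Y hX hY hXr hYr u hu hu0
  have h2 : 0 < 2 * π * h := by positivity
  set S : ℝ := ∫ x, ‖u x‖ ^ 2 with hS
  have hS0 : 0 ≤ S := integral_nonneg fun _ => by positivity
  -- the constant dominates both regimes
  have hpowmul : (2 * π) ^ β * h ^ β = (2 * π * h) ^ β := (Real.mul_rpow h2πpos.le hh.le).symm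
  rcases le_or_gt (2 * π * h) 1 with hsmall | hlarge
  · /- **Regime `2πh ≤ 1`: BD18 Theorem 4 with `N = (2πh)⁻¹`.** -/
    set N : ℝ := (2 * π * h)⁻¹ with hN
    have hNpos : 0 < N := inv_pos.2 h2
    have hN1 : 1 ≤ N := one_le_inv_iff₀.2 ⟨h2, hsmall⟩
    -- the rescaled function and its support
    set g : ℝ → ℂ := fun y => (((2 * π * h) ^ (1 / 2 : ℝ) : ℝ) : ℂ) * u (-(2 * π * h) * y) with hg
    set Y' : Set ℝ := (fun x : ℝ => -x) '' ((fun x => N * x) '' Y) with hY'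
    have hY'sub : Y' ⊆ Icc (-N) N := by
      rintro _ ⟨_, ⟨x, hx, rfl⟩, rfl⟩
      obtain ⟨hx1, hx2⟩ := hY hx
      constructor <;> nlinarith
    have hY'reg : IsRegularSet Y' δ C_R 1 N := by
      have := (hYr.image_mul_left hNpos).image_neg
      refine this.mono_scales ?_ (mul_one N).symm.le
      -- `N * h = (2π)⁻¹ ≤ 1`
      rw [hN, show (2 * π * h)⁻¹ * h = (2 * π)⁻¹ by field_simp]
      exact inv_le_one_of_one_le₀ h2π
    have hXreg : IsRegularSet X δ C_R N⁻¹ 1 := by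
      refine hXr.mono_scales ?_ le_rfl
      rw [hN, inv_inv]
      nlinarith
    have hg0 : ∀ y, y ∉ Y' → g y = 0 := by
      intro y hy
      simp only [hg]
      by_cases huy : u (-(2 * π * h) * y) = 0
      · rw [huy, mul_zero]
      · exfalso
        refine hy ⟨N * (-(2 * π * h) * y), ⟨-(2 * π * h) * y, ?_, rfl⟩, ?_⟩
        · by_contra hnot
          exact huy (hu0 _ hnot)
        · rw [hN]; field_simp
    have hbd' := H N hN1 X Y' hX hY'sub hXreg hY'reg g (memLp_rescale hh hu) hg0
    -- rewrite both sides in terms of `u`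
    have hlhs : ∫ ξ in X, ‖fourierSemiclassical h u ξ‖ ^ 2 = ∫ ξ in X, ‖(𝓕⁻ g : ℝ → ℂ) ξ‖ ^ 2 := by
      simp only [fourierSemiclassical_eq_fourierInv hh u, hg]
    rw [hlhs]
    refine hbd'.trans ?_
    rw [integral_norm_sq_rescale hh u]
    refine mul_le_mul_of_nonneg_right ?_ hS0
    -- `(C N^{-β})² ≤ ((|C|+3)(2π)^β h^β)²`
    have hNβ : N ^ (-β) = (2 * π * h) ^ β := by
      rw [hN, Real.rpow_neg (inv_pos.2 h2).le, Real.inv_rpow h2.le, inv_inv]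
    rw [← sq_abs (C * N ^ (-β)), abs_mul, hNβ, abs_of_nonneg (Real.rpow_nonneg h2.le _)]
    refine pow_le_pow_left₀ (by positivity) ?_ 2
    rw [← hpowmul, ← mul_assoc]
    gcongr
    linarith [abs_nonneg C]
  · /- **Regime `2πh > 1`: the trivial bound.** -/
    have hu0' : ∀ x, x ∉ Icc (-1 : ℝ) 1 → u x = 0 := fun x hx => hu0 x fun hxY => hx (hY hxY)
    have hCS := sq_integral_norm_le_of_support hu hu0'
    -- pointwise: `|𝓕_h u(ξ)|² ≤ (2πh)⁻¹ (∫|u|)² ≤ (9/4) S`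
    set B : ℝ := (2 * π * h) ^ (-(1 / 2 : ℝ)) * ∫ x, ‖u x‖ with hB
    have hB0 : 0 ≤ B := mul_nonneg (Real.rpow_nonneg h2.le _) (integral_nonneg fun _ => norm_nonneg _)
    have hBsq : B ^ 2 ≤ 9 / 4 * S := by
      have hp : ((2 * π * h) ^ (-(1 / 2 : ℝ))) ^ 2 = (2 * π * h)⁻¹ := by
        rw [← Real.rpow_natCast, ← Real.rpow_mul h2.le,
          show (-(1 / 2 : ℝ)) * ((2 : ℕ) : ℝ) = -1 by norm_num, Real.rpow_neg_one]
      rw [hB, mul_pow, hp]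
      have hinv : (2 * π * h)⁻¹ ≤ 1 := inv_le_one_of_one_le₀ hlarge.le
      calc (2 * π * h)⁻¹ * (∫ x, ‖u x‖) ^ 2 ≤ 1 * (∫ x, ‖u x‖) ^ 2 :=
            mul_le_mul_of_nonneg_right hinv (sq_nonneg _)
        _ ≤ 9 / 4 * S := by rw [one_mul]; exact hCS
    have hpt : ∀ ξ, ‖fourierSemiclassical h u ξ‖ ^ 2 ≤ B ^ 2 := fun ξ =>
      pow_le_pow_left₀ (norm_nonneg _) (norm_fourierSemiclassical_le hh u ξ) 2
    have hvolX : volume X ≠ ⊤ :=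
      (measure_mono hX).trans_lt (by rw [Real.volume_Icc]; exact ENNReal.ofReal_lt_top) |>.ne
    have hI : ∫ ξ in X, ‖fourierSemiclassical h u ξ‖ ^ 2 ≤ ∫ ξ in X, B ^ 2 := by
      refine integral_mono_of_nonneg (Filter.Eventually.of_forall fun _ => by positivity)
        ?_ (Filter.Eventually.of_forall hpt)
      exact integrableOn_const hvolX
    have hI2 : ∫ ξ in X, B ^ 2 ≤ 2 * B ^ 2 := by
      rw [setIntegral_const, smul_eq_mul]
      refine mul_le_mul_of_nonneg_right ?_ (sq_nonneg _)
      calc volume.real X ≤ volume.real (Icc (-1 : ℝ) 1) :=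
            measureReal_mono hX (by rw [Real.volume_Icc]; exact ENNReal.ofReal_ne_top)
        _ = 2 := by rw [Real.volume_real_Icc_of_le (by norm_num)]; norm_num
    refine hI.trans (hI2.trans ?_)
    -- `2 B² ≤ (9/2) S ≤ 9 S ≤ ((|C|+3) (2π)^β h^β)² S`
    have hone : 1 ≤ (2 * π) ^ β * h ^ β := by
      rw [hpowmul]; exact Real.one_le_rpow hlarge.le hβ.le
    have h9 : 9 ≤ ((|C| + 3) * (2 * π) ^ β * h ^ β) ^ 2 := by
      have h3 : 3 ≤ (|C| + 3) * (2 * π) ^ β * h ^ β := by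
        rw [mul_assoc]
        nlinarith [abs_nonneg C]
      nlinarith
    nlinarith

/-! ## The FUP for porous sets in `[-1, 1]` from BD18 Theorem 4 (Dyatlov 2019, Theorem 3) -/

/-- `𝓕_h u` is continuous for `u ∈ L¹(ℝ)` (it is the Fourier integral of the integrable function
`y ↦ (2πh)^{1/2} u(2πh y)`, `fourierSemiclassical_eq_fourierInv`). [folklore] -/
theorem continuous_fourierSemiclassical {h : ℝ} (hh : 0 < h) {u : ℝ → ℂ} (hu : Integrable u) :
    Continuous (fourierSemiclassical h u) := by
  have h2 : 0 < 2 * π * h := by positivity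
  have hint : Integrable
      (fun y : ℝ => (((2 * π * h) ^ (1 / 2 : ℝ) : ℝ) : ℂ) * u ((2 * π * h) * y)) :=
    (hu.comp_mul_left' h2.ne').const_mul _
  have e : fourierSemiclassical h u =
      (𝓕 (fun y : ℝ => (((2 * π * h) ^ (1 / 2 : ℝ) : ℝ) : ℂ) * u ((2 * π * h) * y)) : ℝ → ℂ) := by
    funext ξ
    rw [fourierSemiclassical_eq_fourierInv hh u ξ, Real.fourierInv_eq_fourier_comp_neg]
    simp only [neg_mul_neg]
  rw [e]
  exact VectorFourier.fourierIntegral_continuous Real.continuous_fourierChar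
    (by exact continuous_inner) hint

/-- **The fractal uncertainty principle for `ν`-porous sets in `[-1, 1]`, from BD18 Theorem 4**
(Dyatlov 2019, Theorem 3: "Fix `ν > 0`. Then there exists `β = β(ν) > 0` such that
`‖𝟙_X 𝓕_h 𝟙_Y‖_{L² → L²} = O(h^β)` as `h → 0` holds for all `h`-dependent families of sets
`X, Y ⊂ [0,1]` which are `ν`-porous on scales `h` to `1`"; Dyatlov–Jin 2018, Prop. 5.5 with
`Φ = xy`; the bounded case of [DyatlovJinNonnenmacher2021, Prop. 2.9] = its Step 4 for one pair
of unit windows), for `0 < ν < 1`, sets in `[-1, 1] ⊇ [0, 1]`, uniform constant `C = C(ν)` and all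
`0 < h ≤ 1`, in the quadratic-form rendering of `PorousFractalUncertainty.lean`: for
`u ∈ L¹ ∩ L²` vanishing off `Y`, `∫_X |𝓕_h u|² ≤ (C h^β)² ∫ |u|²`. Proof as printed ("an
application of Theorem 1 and Proposition 1(2)"): `X ⊆ X̃`, `Y ⊆ Ỹ` with `X̃, Ỹ ⊆ [-1,1]`
`δ(ν)`-regular with constant `C_R(ν)` on scales `h` to `1` (`exists_regular_superset_of_porous`),
then `∫_X ≤ ∫_{X̃}` and `fup_regular_semiclassical_of_bd18` for `(X̃, Ỹ)`. Compare
`dyatlov2019_thm3_of`, the same statement (with `h < 1` and measurability hypotheses) from the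
DJN fact instead of the BD18 fact. [cite: Dyatlov2019, §2.3 Theorem 3] [cite: DyatlovJin2018Acta, §5.1 Lemma 5.4 and Proposition 5.5] [cite: DyatlovJinNonnenmacher2021, §2.4, proof of Prop. 2.9, Step 4] [cite: BourgainDyatlov2018, Theorem 4] -/
theorem dyatlov2019_thm3_of_bd18 (hbd : bourgainDyatlov2018_thm4) {ν : ℝ} (hν0 : 0 < ν)
    (hν1 : ν < 1) :
    ∃ β : ℝ, 0 < β ∧ ∃ C : ℝ, 0 < C ∧ ∀ h : ℝ, 0 < h → h ≤ 1 →
      ∀ X Y : Set ℝ, X ⊆ Icc (-1) 1 → Y ⊆ Icc (-1) 1 →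
        IsPorousOnScales X ν h 1 → IsPorousOnScales Y ν h 1 →
          ∀ u : ℝ → ℂ, Integrable u → MemLp u 2 volume → (∀ x, x ∉ Y → u x = 0) →
            ∫ ξ in X, ‖fourierSemiclassical h u ξ‖ ^ 2 ≤ (C * h ^ β) ^ 2 * ∫ x, ‖u x‖ ^ 2 := by
  obtain ⟨δ, hδ0, hδ1, C_R, hCR, hcov⟩ := exists_regular_superset_of_porous hν0 hν1
  obtain ⟨β, hβ, C, hC, H⟩ := fup_regular_semiclassical_of_bd18 hbd δ C_R hδ0 hδ1 hCR
  refine ⟨β, hβ, C, hC, ?_⟩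
  intro h hh hh1 X Y hX hY hXp hYp u hu1 hu2 hu0
  obtain ⟨X', hXX', hX'I, hX'r⟩ := hcov h hh hh1 X hX hXp
  obtain ⟨Y', hYY', hY'I, hY'r⟩ := hcov h hh hh1 Y hY hYp
  have hu0' : ∀ x, x ∉ Y' → u x = 0 := fun x hx => hu0 x fun hxY => hx (hYY' hxY)
  refine le_trans ?_ (H h hh hh1 X' Y' hX'I hY'I hX'r hY'r u hu2 hu0')
  have hcont : Continuous fun ξ => ‖fourierSemiclassical h u ξ‖ ^ 2 :=
    ((continuous_fourierSemiclassical hh hu1).norm).pow 2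
  exact setIntegral_mono_set ((hcont.integrableOn_Icc).mono_set hX'I)
    (Filter.Eventually.of_forall fun _ => by positivity) hXX'.eventuallyLE

/-! ## Translation invariance and the estimate for an arbitrary pair of windows -/

/-- **Translation ↦ phase.** `𝓕_h (u(· + k))(ξ) = e^{ikξ/h} 𝓕_h u(ξ)` (substitute `y = x + k`; no
integrability needed). [folklore] -/
theorem fourierSemiclassical_comp_add_right (h : ℝ) (u : ℝ → ℂ) (k ξ : ℝ) :
    fourierSemiclassical h (fun x => u (x + k)) ξ =
      Complex.exp (Complex.I * (k : ℂ) * (ξ : ℂ) / (h : ℂ)) * fourierSemiclassical h u ξ := by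
  rw [fourierSemiclassical, fourierSemiclassical, mul_left_comm]
  congr 1
  set G : ℝ → ℂ := fun y => Complex.exp (-(Complex.I * ((y - k : ℝ) : ℂ) * (ξ : ℂ) / (h : ℂ))) * u y
    with hG
  have hGk : ∀ x : ℝ, Complex.exp (-(Complex.I * (x : ℂ) * (ξ : ℂ) / (h : ℂ))) * u (x + k) =
      G (x + k) := by
    intro x; simp only [hG, add_sub_cancel_right]
  simp_rw [hGk]
  rw [integral_add_right_eq_self G k, hG, ← integral_const_mul]
  refine integral_congr_ae (Filter.Eventually.of_forall fun y => ?_)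
  simp only
  rw [← mul_assoc, ← Complex.exp_add]
  congr 2
  push_cast
  ring

/-- **Modulation ↦ frequency shift.** `𝓕_h (e^{-ixj/h} u)(η) = 𝓕_h u(η + j)`. [folklore] -/
theorem fourierSemiclassical_modulate (h : ℝ) (u : ℝ → ℂ) (j η : ℝ) :
    fourierSemiclassical h (fun x => Complex.exp (-(Complex.I * (x : ℂ) * (j : ℂ) / (h : ℂ))) * u x) η =
      fourierSemiclassical h u (η + j) := by
  rw [fourierSemiclassical, fourierSemiclassical]
  congr 1
  refine integral_congr_ae (Filter.Eventually.of_forall fun x => ?_)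
  simp only
  rw [← mul_assoc, ← Complex.exp_add]
  congr 2
  push_cast
  ring

/-- **The porous FUP for an arbitrary pair of unit windows, from BD18 Theorem 4** — the bound
`‖𝟙_{X} 𝓕_h 𝟙_{Y}‖ ≤ C h^β` for `X ⊆ [j-1, j+1]`, `Y ⊆ [k-1, k+1]` `ν`-porous on scales `h` to `1`,
uniformly in `j, k ∈ ℝ`: this is estimate (2.38) of [DyatlovJinNonnenmacher2021, proof of
Prop. 2.9] for the sharp-cutoff pieces, obtained from the case `j = k = 0`
(`dyatlov2019_thm3_of_bd18`) because "the norm `‖𝟙_X 𝓕_h^* 𝟙_Y‖_{L² → L²}` does not change when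
shifting `X` and/or `Y`" (Step 4): shifting `Y` by `k` is the translation `u ↦ u(· + k)`, which
multiplies `𝓕_h u` by the phase `e^{ikξ/h}` (`fourierSemiclassical_comp_add_right`); shifting `X`
by `j` is the modulation `u ↦ e^{-ixj/h} u` (`fourierSemiclassical_modulate`); porosity is
translation invariant (`IsPorousOnScales.image_add_const`). [cite: DyatlovJinNonnenmacher2021, §2.4, proof of Prop. 2.9, Step 4, (2.38) and (2.41)] [cite: Dyatlov2019, §2.3 Theorem 3] [cite: BourgainDyatlov2018, Theorem 4] -/
theorem porousFUP_window_of_bd18 (hbd : bourgainDyatlov2018_thm4) {ν : ℝ} (hν0 : 0 < ν)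
    (hν1 : ν < 1) :
    ∃ β : ℝ, 0 < β ∧ ∃ C : ℝ, 0 < C ∧ ∀ h : ℝ, 0 < h → h ≤ 1 → ∀ j k : ℝ,
      ∀ X Y : Set ℝ, X ⊆ Icc (j - 1) (j + 1) → Y ⊆ Icc (k - 1) (k + 1) →
        IsPorousOnScales X ν h 1 → IsPorousOnScales Y ν h 1 →
          ∀ u : ℝ → ℂ, Integrable u → MemLp u 2 volume → (∀ x, x ∉ Y → u x = 0) →
            ∫ ξ in X, ‖fourierSemiclassical h u ξ‖ ^ 2 ≤ (C * h ^ β) ^ 2 * ∫ x, ‖u x‖ ^ 2 := by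
  obtain ⟨β, hβ, C, hC, H⟩ := dyatlov2019_thm3_of_bd18 hbd hν0 hν1
  refine ⟨β, hβ, C, hC, ?_⟩
  intro h hh hh1 j k X Y hX hY hXp hYp u hu1 hu2 hu0
  -- shifted sets
  set X' : Set ℝ := (fun x => x + -j) '' X with hX'
  set Y' : Set ℝ := (fun x => x + -k) '' Y with hY'
  have hX'e : X' = (fun η => η + j) ⁻¹' X := by
    ext η
    simp only [hX', mem_image, mem_preimage]
    constructor
    · rintro ⟨x, hx, rfl⟩; simpa using hx
    · intro hη; exact ⟨η + j, hη, by ring⟩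
  have hX'sub : X' ⊆ Icc (-1) 1 := by
    rintro _ ⟨x, hx, rfl⟩; obtain ⟨h1, h2⟩ := hX hx; constructor <;> linarith
  have hY'sub : Y' ⊆ Icc (-1) 1 := by
    rintro _ ⟨x, hx, rfl⟩; obtain ⟨h1, h2⟩ := hY hx; constructor <;> linarith
  have hX'p : IsPorousOnScales X' ν h 1 := hXp.image_add_const (-j)
  have hY'p : IsPorousOnScales Y' ν h 1 := hYp.image_add_const (-k)
  -- the translated and modulated function
  set v : ℝ → ℂ := fun x => u (x + k) with hv
  set w : ℝ → ℂ := fun x => Complex.exp (-(Complex.I * (x : ℂ) * (j : ℂ) / (h : ℂ))) * v x with hw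
  have hunit : ∀ x : ℝ, ‖Complex.exp (-(Complex.I * (x : ℂ) * (j : ℂ) / (h : ℂ)))‖ = 1 := by
    intro x
    rw [show -(Complex.I * (x : ℂ) * (j : ℂ) / (h : ℂ)) = ((-(x * j / h) : ℝ) : ℂ) * Complex.I by
      push_cast; ring, Complex.norm_exp_ofReal_mul_I]
  have hnorm : ∀ x, ‖w x‖ = ‖v x‖ := by intro x; rw [hw]; simp only [norm_mul, hunit, one_mul]
  have hv1 : Integrable v := hu1.comp_add_right k
  have hv2 : MemLp v 2 volume := hu2.comp_measurePreserving (measurePreserving_add_right volume k)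
  have hwm : AEStronglyMeasurable w volume := by
    refine (Continuous.aestronglyMeasurable ?_).mul hv1.aestronglyMeasurable
    fun_prop
  have hw1 : Integrable w :=
    hv1.bdd_mul (c := 1) (Continuous.aestronglyMeasurable (by fun_prop))
      (Filter.Eventually.of_forall fun x => (hunit x).le)
  have hw2 : MemLp w 2 volume := hv2.of_le hwm (Filter.Eventually.of_forall fun x => (hnorm x).le)
  have hw0 : ∀ x, x ∉ Y' → w x = 0 := by
    intro x hx
    have : u (x + k) = 0 := hu0 _ fun hxk => hx ⟨x + k, hxk, by ring⟩
    simp only [hw, hv, this, mul_zero]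
  have key := H h hh hh1 X' Y' hX'sub hY'sub hX'p hY'p w hw1 hw2 hw0
  -- compare both sides
  have hfun : ∀ η : ℝ, ‖fourierSemiclassical h u (η + j)‖ ^ 2 =
      ‖fourierSemiclassical h w η‖ ^ 2 := by
    intro η
    have e1 : fourierSemiclassical h w η =
        Complex.exp (Complex.I * (k : ℂ) * ((η + j : ℝ) : ℂ) / (h : ℂ)) *
          fourierSemiclassical h u (η + j) := by
      rw [hw, fourierSemiclassical_modulate h v j η, hv,
        fourierSemiclassical_comp_add_right h u k (η + j)]
    rw [e1, norm_mul, show Complex.I * (k : ℂ) * ((η + j : ℝ) : ℂ) / (h : ℂ) =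
      ((k * (η + j) / h : ℝ) : ℂ) * Complex.I by push_cast; ring, Complex.norm_exp_ofReal_mul_I,
      one_mul]
  have hlhs : ∫ ξ in X, ‖fourierSemiclassical h u ξ‖ ^ 2 =
      ∫ η in X', ‖fourierSemiclassical h w η‖ ^ 2 := by
    have hL := ((measurePreserving_add_right volume j).setIntegral_preimage_emb
      (show MeasurableEmbedding (fun x : ℝ => x + j) from
        (MeasurableEquiv.addRight j).measurableEmbedding)
      (fun ξ => ‖fourierSemiclassical h u ξ‖ ^ 2) X).symm
    rw [hL, hX'e]
    simp only [hfun]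
  have hR : ∫ x, ‖w x‖ ^ 2 = ∫ x, ‖u x‖ ^ 2 := by
    simp_rw [hnorm]
    exact integral_add_right_eq_self (fun x => ‖u x‖ ^ 2) k
  calc ∫ ξ in X, ‖fourierSemiclassical h u ξ‖ ^ 2
      = ∫ η in X', ‖fourierSemiclassical h w η‖ ^ 2 := hlhs
    _ ≤ (C * h ^ β) ^ 2 * ∫ x, ‖w x‖ ^ 2 := key
    _ = (C * h ^ β) ^ 2 * ∫ x, ‖u x‖ ^ 2 := by rw [hR]

end Literature.Analysis.Fourier
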